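import Summits.RiemannHypothesis.RiemannHypothesis.Theses.EtaLeadingQuarter
import HarnessLib

/-!
# Route EtaLeadingQuarter (L18) — `Assembly` (item stmt-RiemannHypothesis-21794)

`EtaLeadingSecondMoment → WeakLockingLayer → QuarterTrialVectors → IntegerScrew.ScrewFloorLimsupQuarter` is
the type of the route's deciding theorem `Theses.EtaLeadingQuarter.closes` (rev 1, route file sha16
8d82f908339a1ba9): under RH, `QuarterTrialVectors` fed with the two cruxes yields, eventually in `M`, a
non-zero `v` with `M · screwRayleigh M v ≤ 1/4 + ε`; when `screwMatrix (M − 1)` is positive definite the floor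
is below every Rayleigh quotient (`screwFloor_le_of_posDef`), otherwise the floor is `≤ 0`
(`screwFloor_nonpos_of_not_posDef`); without RH the leaf holds by
`screwFloorLimsupQuarter_of_not_riemannHypothesis`. Port of the planner's `closes` body (rh-idea-7 g0)
against the route decls. CONDITIONAL bookkeeping: the cruxes `EtaLeadingSecondMoment`, `WeakLockingLayer`
and the support `QuarterTrialVectors` stay OPEN — neither the leaf nor RH is proved by this; nothing here
bears on the truth of RH.
-/

-- D-0017: `Summit.RiemannHypothesis.RiemannHypothesis.…` duplicates the namespace BY DESIGN (single-problem summit).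
set_option linter.dupNamespace false

namespace Summit.RiemannHypothesis.RiemannHypothesis.Theorems.EtaLeadingQuarter

open Summit.RiemannHypothesis.RiemannHypothesis.Theorems.IntegerScrew in
/-- **`Assembly` (item stmt-RiemannHypothesis-21794) holds**: case split on RH and on positive definiteness
of `screwMatrix (M − 1)`; same proof as the route's `closes`. -/
theorem assembly_proof :
    Summit.RiemannHypothesis.RiemannHypothesis.Theses.EtaLeadingQuarter.Assembly := by
  intro h₁ h₂ h₃
  by_cases hRH : _root_.RiemannHypothesis
  · intro ε hε
    filter_upwards [h₃ h₁ h₂ hRH ε hε] with M hM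
    by_cases hPD : (screwMatrix (M - 1)).PosDef
    · obtain ⟨v, hv, hle⟩ := hM
      exact (screwFloor_le_of_posDef hPD hv).trans hle
    · exact (screwFloor_nonpos_of_not_posDef hPD).trans (by linarith)
  · exact screwFloorLimsupQuarter_of_not_riemannHypothesis hRH

end Summit.RiemannHypothesis.RiemannHypothesis.Theorems.EtaLeadingQuarter
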